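import Summits.Ventures.QEC.Census.CertInfoSetOrbit
import Summits.Ventures.QEC.Census.CertCheckMitm
import HarnessLib

/-!
# Orbit-averaged information-set lower bounds for CSS distance certificates — soundness
# (qec-search-4 g4; companion of `Census/CertInfoSetOrbit.lean`)

For one side of a CSS certificate (syndrome rows `Hsyn`, stabilizer rows `Hstab` on `n` qubits, commuting) the
hypotheses are exactly the kernel verdicts an emitted row file proves by `decide +kernel`:

* `foundOK Hstab found` — the allow-list decomposes over the stabilizer rows (inside `DistCert.checkStructure`);
* `autGensOK n Hsyn Hstab gens`, `autWordsOK gens.length words` — type-12's automorphism generators and words;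
* `infoSetStructOK n Hsyn (view s).ic` for every view — search-7's reduced-row-echelon certificates;
* `Reaches (bzLeaf wmax allow) (rowPos (kerBasis …) 0) t_s 0 0` for every view — the depth-`t_s` replay of the view's
  kernel basis (type-01's lane engine `Plane.segOK` through `Plane.reaches_of_segList`, or `scan`);
* `orbitProfileOK n wmax (words ↦ tables) views cls μ` — the class table and the profile enumeration.

CONCLUSION (`orbit_lower_sound`): every vector with zero `Hsyn`-syndrome outside the `Hstab` row space has weight
`> wmax` — the `lowZ` / `lowX` shape consumed by `DistCert.isCode_of_onesided_lower` / `CSSCode.dZ_eq_of_witness`; wrappers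
`DistCert.lowZ_of_orbit` / `lowX_of_orbit` / `dZ_code_of_orbit` / `dX_code_of_orbit`.  PROOF = the double count of the
companion file, the transport `orbit_transport` (type-12 `zLogical_comp_equiv_symm_of_rowMap`), the decomposition
`eq_ofBits_freeSupp` over the view's kernel basis, and the `rowPos` bridge to the replay's `Reaches` statement.
HONEST FRAMING: no certificate is read here and no distance value is asserted; tier KERNEL, axioms ⊆ {propext,
Classical.choice, Quot.sound}; no `native_decide`.  Sources: automorphism reduction of minimum-weight enumeration
[Grassl 2006 §2.2]; the Lean ingredients are qec-search-7 `CertInfoSet(Sound)` (p-ids in that file), qec-type-12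
`BZAutPerm` / `AutomorphismLabelAction`, qec-type-01 `CertBZPlane(Sound)`.
-/

set_option autoImplicit false

namespace Summit.Ventures.QEC.Census

open Matrix Literature.InformationTheory.QuantumCodes

/-! ## From a sub-list of a word list to the lane engine's position list -/

section RowPos

/-- A sub-list `S'` of the row words `G` is realised by a sub-list `S` of `rowPos G j₀` (the lane engine's position list:
`(2^j, G[j])`) with the same word XOR, the same length, a selection word with no bits below `j₀`, and a NONZERO selection
word when `S'` is nonempty. -/
theorem exists_rowPos_sublist : ∀ (G : List ℕ) (j₀ : ℕ) (S' : List ℕ), S'.Sublist G →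
    ∃ S : List (ℕ × ℕ), S.Sublist (rowPos G j₀) ∧ xorSnd S = xorList S' ∧ S.length = S'.length ∧
      (∀ i, i < j₀ → (xorFst S).testBit i = false) ∧ (S' ≠ [] → xorFst S ≠ 0)
  | [], j₀, S', h => by
    have : S' = [] := List.sublist_nil.mp h
    subst this
    exact ⟨[], List.Sublist.slnil, rfl, rfl, fun i _ => by simp [xorFst, xorList], fun h => absurd rfl h⟩
  | g :: G, j₀, S', h => by
    rcases h with _ | ⟨_, h'⟩ | ⟨_, h'⟩
    · -- skip `g`
      obtain ⟨S, hS, hx, hl, hlow, hne⟩ := exists_rowPos_sublist G (j₀ + 1) S' h'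
      refine ⟨S, ?_, hx, hl, fun i hi => hlow i (by omega), hne⟩
      rw [rowPos]
      exact hS.cons _
    · -- take `g`
      rename_i S''
      obtain ⟨S, hS, hx, hl, hlow, -⟩ := exists_rowPos_sublist G (j₀ + 1) S'' h'
      refine ⟨(2 ^ j₀, g) :: S, ?_, ?_, ?_, ?_, ?_⟩
      · rw [rowPos]; exact hS.cons_cons _
      · rw [xorSnd_cons, hx, xorList]
      · rw [List.length_cons, List.length_cons, hl]
      · intro i hi
        rw [xorFst_cons, Nat.testBit_xor, hlow i (by omega), Nat.testBit_two_pow_of_ne (by omega)]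
        rfl
      · intro _ h0
        have hb := congrArg (fun x => Nat.testBit x j₀) h0
        simp only [xorFst_cons, Nat.zero_testBit, Nat.testBit_xor, Nat.testBit_two_pow_self, hlow j₀ (by omega)] at hb
        simp at hb

end RowPos

section Sound

variable {n : ℕ} {Hsyn Hstab : List ℕ}

/-- **Transport by a word in checked automorphism generators** (type-12's `bzAut_perm_hφ` without the label identity):
`z ∘ σ_w⁻¹` is a non-trivial logical of the same weight whenever `z` is. -/
theorem orbit_transport (hcomm : rowMatrix n Hsyn * (rowMatrix n Hstab)ᵀ = 0)
    {gens : List AutGen} (hgens : autGensOK n Hsyn Hstab gens = true)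
    {wd : List ℕ} (hwd : ∀ g ∈ wd, g < gens.length) (z : Fin n → ZMod 2)
    (hz : rowMatrix n Hsyn *ᵥ z = 0) (hz' : z ∉ rowSpace (rowMatrix n Hstab)) :
    rowMatrix n Hsyn *ᵥ (z ∘ (wordEquiv n (autPerms gens) wd).symm) = 0 ∧
      z ∘ (wordEquiv n (autPerms gens) wd).symm ∉ rowSpace (rowMatrix n Hstab) ∧
      hammingNorm (z ∘ (wordEquiv n (autPerms gens) wd).symm) = hammingNorm z := by
  let C : CSSCode (Fin Hsyn.length) (Fin Hstab.length) (Fin n) :=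
    CSSCode.ofMatrices (rowMatrix n Hsyn) (rowMatrix n Hstab) hcomm
  have hng : (autPerms gens).length = gens.length := List.length_map ..
  have hw : ∀ g ∈ wd, g < (autPerms gens).length := by rw [hng]; exact hwd
  obtain ⟨ρX, hXsub⟩ := exists_submatrix_eq_wordEquiv (H := Hsyn) (permListOK_of_autGensOK hgens)
    (rowMapOK_syn_of_autGensOK hgens) wd hw
  obtain ⟨ρZ, hZsub⟩ := exists_submatrix_eq_wordEquiv (H := Hstab) (permListOK_of_autGensOK hgens)
    (rowMapOK_stab_of_autGensOK hgens) wd hw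
  obtain ⟨h1, h2⟩ := C.zLogical_comp_equiv_symm_of_rowMap hXsub hZsub ⟨hz, hz'⟩
  exact ⟨h1, h2, hammingNorm_comp_equiv z _⟩

/-- Length of a filter as a `countB`. -/
theorem length_filter_eq_countB (p : ℕ → Bool) : ∀ (l : List ℕ), (l.filter p).length = countB p l
  | [] => rfl
  | x :: xs => by
    rw [List.filter_cons, countB_cons]
    cases hp : p x
    · simp [length_filter_eq_countB p xs]
    · simp [length_filter_eq_countB p xs, Nat.add_comm]

/-- **The free support of a transported vector**: `z ∘ σ⁻¹` has as many free support points as there are support points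
`x` of `z` with `σ x` free — counted on a TABLE `f` of `σ` (`f q = σ q` on `q < n`). -/
theorem length_freeSupp_comp_symm (piv : List ℕ) (σ : Fin n ≃ Fin n) (z : Fin n → ZMod 2) (f : ℕ → ℕ)
    (hf : ∀ q : Fin n, f q = ((σ q : Fin n) : ℕ)) :
    (freeSupp n piv (z ∘ σ.symm)).length = countB (fun x => isFree piv (f x)) (suppIdx n z) := by
  rw [freeSupp, length_filter_eq_countB, show (fun j => !(piv.elem j)) = isFree piv from rfl, countB_suppIdx,
    countB_suppIdx]
  have hset : (Finset.univ.filter fun i : Fin n => (z ∘ σ.symm) i ≠ 0 ∧ isFree piv i = true) =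
      (Finset.univ.filter fun x : Fin n => z x ≠ 0 ∧ isFree piv (f x) = true).map σ.toEmbedding := by
    ext i
    simp only [Finset.mem_filter, Finset.mem_univ, true_and, Finset.mem_map_equiv, Function.comp_apply]
    rw [hf (σ.symm i), Equiv.apply_symm_apply]
  rw [hset, Finset.card_map]

/-- The default view (used only as the `getD` filler). (definition) -/
def dfltView : OrbitView := ⟨⟨[], [], []⟩, 0⟩

/-- **Soundness of the orbit-averaged information-set lane (one side).**  See the file header. -/
theorem orbit_lower_sound (hcomm : rowMatrix n Hsyn * (rowMatrix n Hstab)ᵀ = 0) {found : List (ℕ × List ℕ)}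
    (hfound : foundOK Hstab found = true)
    {gens : List AutGen} (hgens : autGensOK n Hsyn Hstab gens = true)
    {words : List (List ℕ)} (hwords : autWordsOK gens.length words = true)
    {views : List OrbitView}
    (hviews : ∀ s, s < views.length → infoSetStructOK n Hsyn (views.getD s dfltView).ic = true)
    {wmax : ℕ}
    (hreach : ∀ s, s < views.length → Reaches (bzLeaf wmax (found.map Prod.fst))
      (rowPos (kerBasis n (views.getD s dfltView).ic.piv (views.getD s dfltView).ic.red) 0)
      (views.getD s dfltView).t 0 0)
    {cls : List ℕ} {μ : List (List ℕ)}
    (hprof : orbitProfileOK n wmax (words.map (wordPerm n (autPerms gens))) views cls μ = true)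
    (w : Fin n → ZMod 2) (hw : rowMatrix n Hsyn *ᵥ w = 0) (hw' : w ∉ rowSpace (rowMatrix n Hstab)) :
    wmax < hammingNorm w := by
  by_contra hle
  rw [not_lt] at hle
  -- the tables
  set tabs := words.map (wordPerm n (autPerms gens)) with htabs
  have hq : tabs.length = words.length := by rw [htabs, List.length_map]
  simp only [orbitProfileOK, Bool.and_eq_true] at hprof
  obtain ⟨hmt, hgo⟩ := hprof
  simp only [multTabOK, Bool.and_eq_true, beq_iff_eq, List.all_eq_true, List.mem_range, decide_eq_true_eq] at hmt
  obtain ⟨-, hmt⟩ := hmt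
  -- the support
  set L := suppIdx n w with hL
  have hLlen : L.length = hammingNorm w := by
    have := length_suppList n [] w
    rwa [suppList, List.length_map] at this
  have hw0 : w ≠ 0 := fun h0 => hw' (h0 ▸ Submodule.zero_mem _)
  have hLpos : 0 < L.length := by rw [hLlen]; exact hammingNorm_pos_iff.2 hw0
  have hLlt : ∀ x ∈ L, x < n := fun x hx => lt_of_mem_suppIdx n w hx
  have hLsub : L.Sublist (List.range n) := by
    rw [hL, suppIdx, ← List.map_coe_finRange_eq_range]
    exact (List.filter_sublist).map _
  -- the class profile of the support
  set m := μ.length with hm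
  set ps := profileOf cls m L with hps
  have hcls : ∀ x ∈ L, cls.getD x 0 < m := fun x hx => (hmt x (hLlt x hx)).1
  have hpslen : ps.length = μ.length := length_profileOf cls m L
  have hpssum : ps.sum = L.length := sum_profileOf cls m L hcls
  have hpscap : ∀ j, j < μ.length → ps.getD j 0 ≤ (classSizes n m cls).getD j 0 := by
    intro j hj
    rw [hps, getD_profileOf _ _ _ hj, classSizes, List.getD_eq_getElem?_getD, List.getElem?_map,
      List.getElem?_range hj, Option.map_some, Option.getD_some]
    exact countB_le_of_sublist _ hLsub
  rcases profGo_sound μ (classSizes n m cls) wmax 0 (List.replicate views.length 0) (orbBounds tabs.length views) hgo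
      ps hpslen hpscap (by rw [hpssum, hLlen]; exact hle) with h0 | ⟨s, hs1, hs2, hlt⟩
  · omega
  rw [List.length_replicate] at hs1
  set V := views.getD s dfltView with hV
  have hacc : (List.replicate views.length 0).getD s 0 = 0 := by
    rw [List.getD_eq_getElem?_getD, List.getElem?_replicate, if_pos hs1, Option.getD_some]
  have hbnd : (orbBounds tabs.length views).getD s 0 = tabs.length * (V.t + 1) := by
    rw [orbBounds, List.getD_eq_getElem?_getD, List.getElem?_map, List.getElem?_eq_getElem hs1, Option.map_some,
      Option.getD_some, hV, List.getD_eq_getElem?_getD, List.getElem?_eq_getElem hs1, Option.getD_some]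
  rw [hacc, hbnd, zero_add] at hlt
  -- Σ_{x ∈ L} mult_s x = Σ_j p_j μ[j][s]
  have hsumL : (L.map fun x => orbMult tabs V.ic.piv x).sum = profSum ps μ s := by
    rw [sum_map_eq_profSum_aux cls m (fun x => orbMult tabs V.ic.piv x) (fun j => (μ.getD j []).getD s 0) L hcls
      (fun x hx => (hmt x (hLlt x hx)).2 s hs1), profSum]
    refine congrArg List.sum (List.map_congr_left fun j hj => ?_)
    rw [List.mem_range] at hj
    rw [hps, getD_profileOf _ _ _ hj]
  -- double count: Σ_i #{x ∈ L : tabs[i] x free} = Σ_{x ∈ L} mult_s x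
  have hswap := sum_countB_swap (fun i x => isFree V.ic.piv (permFun (tabs.getD i []) x)) (List.range tabs.length) L
  have hlt' : ((List.range tabs.length).map fun i =>
      countB (fun x => isFree V.ic.piv (permFun (tabs.getD i []) x)) L).sum < (List.range tabs.length).length * (V.t + 1) := by
    rw [hswap, List.length_range]
    change (L.map fun x => orbMult tabs V.ic.piv x).sum < _
    rw [hsumL]
    exact hlt
  obtain ⟨i, hi, hile⟩ := exists_le_of_sum_lt _ V.t (List.range tabs.length) hlt'
  rw [List.mem_range] at hi
  have hiw : i < words.length := hq ▸ hi
  -- the automorphism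
  set wd := words[i] with hwdDef
  have htab : tabs.getD i [] = wordPerm n (autPerms gens) wd := by
    rw [htabs, List.getD_eq_getElem?_getD, List.getElem?_map, List.getElem?_eq_getElem hiw, Option.map_some,
      Option.getD_some]
  have hwd : ∀ g ∈ wd, g < gens.length := lt_of_autWordsOK hwords (List.getElem_mem hiw)
  have hwd' : ∀ g ∈ wd, g < (autPerms gens).length := by rw [List.length_map]; exact hwd
  set σ := wordEquiv n (autPerms gens) wd with hσ
  obtain ⟨hz1, hz2, hz3⟩ := orbit_transport hcomm hgens hwd w hw hw'
  set w' := w ∘ σ.symm with hw'Def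
  have hval : ∀ q : Fin n, permFun (tabs.getD i []) q = ((σ q : Fin n) : ℕ) := fun q => by
    rw [htab]
    exact wordEquiv_val (permListOK_of_autGensOK hgens) wd hwd' q
  have hfree : (freeSupp n V.ic.piv w').length ≤ V.t := by
    rw [hw'Def, length_freeSupp_comp_symm V.ic.piv σ w _ hval]
    exact hile
  -- decomposition over the kernel basis of view `s`
  have hI := hviews s hs1
  rw [← hV] at hI
  simp only [infoSetStructOK, Bool.and_eq_true] at hI
  have hdec := eq_ofBits_freeSupp (Hsyn := Hsyn) hI.1 hI.2 hz1
  set S' := (freeSupp n V.ic.piv w').map (kerVec V.ic.piv V.ic.red) with hS'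
  have hS'sub : S'.Sublist (kerBasis n V.ic.piv V.ic.red) := freeSupp_map_sublist_kerBasis w'
  have hS'ne : S' ≠ [] := by
    intro he
    rw [he, xorList, ofBits_zero] at hdec
    exact hz2 (hdec ▸ Submodule.zero_mem _)
  have hS'len : S'.length ≤ V.t := by rw [hS', List.length_map]; exact hfree
  have hS'lt : xorList S' < 2 ^ n := by
    refine xorList_lt n S' fun x hx => ?_
    rw [hS', List.mem_map] at hx
    obtain ⟨j, hj, rfl⟩ := hx
    exact kerVec_lt_two_pow hI.1 (lt_of_mem_freeSupp w' hj)
  obtain ⟨S, hSsub, hSx, hSlen, -, hSne⟩ := exists_rowPos_sublist _ 0 S' hS'sub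
  have hreachS := hreach s hs1
  rw [← hV] at hreachS
  have hleaf := hreachS S hSsub (by rw [hSlen]; exact hS'len)
  rw [Nat.zero_xor, Nat.zero_xor, bzLeaf, hSx] at hleaf
  simp only [Bool.or_eq_true, beq_iff_eq] at hleaf
  rcases hleaf with (h0 | hwt) | hmem
  · exact hSne hS'ne h0
  · have := lt_popc_of_wtGt n wmax _ hS'lt hwt
    rw [← hammingNorm_ofBits, ← hdec, hz3] at this
    omega
  · apply hz2
    rw [hdec]
    obtain ⟨e, he, hex⟩ : ∃ e ∈ found, e.1 = xorList S' := by
      simpa [List.mem_map] using List.mem_of_elem_eq_true hmem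
    simp only [foundOK, List.all_eq_true, beq_iff_eq] at hfound
    rw [← hex, ← hfound e he]
    exact ofBits_xorRows_mem_rowSpace n Hstab e.2

end Sound

/-! ## The certificate-level statements -/

/-- The data of one side of the orbit lane: automorphism generators (side-oriented row maps), words, views, class map
and class table.  Emitted per code by qec-search-4's `emit_orbit_row.py`. (structure) -/
structure OrbitSide where
  /-- automorphism generators (type-12 `AutGen`: permutation table + row maps on `Hsyn`, `Hstab`) -/
  gens : List AutGen
  /-- the automorphisms used for averaging, as words in the generators -/
  words : List (List ℕ)
  /-- the views: RREF certificates of `Hsyn` + depths -/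
  views : List OrbitView
  /-- class of each qubit -/
  cls : List ℕ
  /-- class table: `μ[j][s]` = multiplicity of class `j` for view `s` -/
  mu : List (List ℕ)

namespace DistCert

variable (c : DistCert)

/-- **`Z`-side lower bound from the orbit lane**: with the structural check (allow-list decompositions), the generator /
word / view-structure / profile verdicts and the per-view replays at threshold `c.dZ − 1`, every non-trivial `Z`-logical
has weight `> c.dZ − 1` (the `lowZ` hypothesis of `isCode_of_onesided_lower`). (theorem) -/
theorem lowZ_of_orbit (hs : c.checkStructure = true) (o : OrbitSide)
    (hgens : autGensOK c.n c.HX c.HZ o.gens = true) (hwords : autWordsOK o.gens.length o.words = true)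
    (hviews : ∀ s, s < o.views.length → infoSetStructOK c.n c.HX (o.views.getD s dfltView).ic = true)
    (hreach : ∀ s, s < o.views.length → Reaches (bzLeaf (c.dZ - 1) (c.sideZ.found.map Prod.fst))
      (rowPos (kerBasis c.n (o.views.getD s dfltView).ic.piv (o.views.getD s dfltView).ic.red) 0)
      (o.views.getD s dfltView).t 0 0)
    (hprof : orbitProfileOK c.n (c.dZ - 1) (o.words.map (wordPerm c.n (autPerms o.gens))) o.views o.cls o.mu = true) :
    ∀ w : Fin c.n → ZMod 2, rowMatrix c.n c.HX *ᵥ w = 0 → w ∉ rowSpace (rowMatrix c.n c.HZ) →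
      c.dZ - 1 < hammingNorm w := by
  have h' := hs
  simp only [checkStructure, Bool.and_eq_true] at h'
  exact orbit_lower_sound (comm_of_commOK (c.commOK_of_checkStructure hs)) h'.1.1.2 hgens hwords hviews hreach hprof

/-- **`X`-side lower bound from the orbit lane** (roles of `H^X`, `H^Z` exchanged; the generators carry the `X`-side
orientation of their row maps). (theorem) -/
theorem lowX_of_orbit (hs : c.checkStructure = true) (o : OrbitSide)
    (hgens : autGensOK c.n c.HZ c.HX o.gens = true) (hwords : autWordsOK o.gens.length o.words = true)
    (hviews : ∀ s, s < o.views.length → infoSetStructOK c.n c.HZ (o.views.getD s dfltView).ic = true)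
    (hreach : ∀ s, s < o.views.length → Reaches (bzLeaf (c.dX - 1) (c.sideX.found.map Prod.fst))
      (rowPos (kerBasis c.n (o.views.getD s dfltView).ic.piv (o.views.getD s dfltView).ic.red) 0)
      (o.views.getD s dfltView).t 0 0)
    (hprof : orbitProfileOK c.n (c.dX - 1) (o.words.map (wordPerm c.n (autPerms o.gens))) o.views o.cls o.mu = true) :
    ∀ w : Fin c.n → ZMod 2, rowMatrix c.n c.HZ *ᵥ w = 0 → w ∉ rowSpace (rowMatrix c.n c.HX) →
      c.dX - 1 < hammingNorm w := by
  have h' := hs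
  simp only [checkStructure, Bool.and_eq_true] at h'
  have hcomm := comm_of_commOK (c.commOK_of_checkStructure hs)
  have hcomm' : rowMatrix c.n c.HZ * (rowMatrix c.n c.HX)ᵀ = 0 := by
    rw [← Matrix.transpose_transpose (rowMatrix c.n c.HZ), ← Matrix.transpose_mul, hcomm, Matrix.transpose_zero]
  exact orbit_lower_sound hcomm' h'.2 hgens hwords hviews hreach hprof

/-- **`d_Z` from the orbit lane** (upper: the certificate's weight-`dZ` witness; lower: `lowZ_of_orbit`). (theorem) -/
theorem dZ_code_of_orbit (hs : c.checkStructure = true) (o : OrbitSide)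
    (hgens : autGensOK c.n c.HX c.HZ o.gens = true) (hwords : autWordsOK o.gens.length o.words = true)
    (hviews : ∀ s, s < o.views.length → infoSetStructOK c.n c.HX (o.views.getD s dfltView).ic = true)
    (hreach : ∀ s, s < o.views.length → Reaches (bzLeaf (c.dZ - 1) (c.sideZ.found.map Prod.fst))
      (rowPos (kerBasis c.n (o.views.getD s dfltView).ic.piv (o.views.getD s dfltView).ic.red) 0)
      (o.views.getD s dfltView).t 0 0)
    (hprof : orbitProfileOK c.n (c.dZ - 1) (o.words.map (wordPerm c.n (autPerms o.gens))) o.views o.cls o.mu = true)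
    (hd : 1 ≤ c.dZ) :
    (c.code (c.commOK_of_checkStructure hs)).dZ = c.dZ := by
  have h' := hs
  simp only [checkStructure, Bool.and_eq_true] at h'
  obtain ⟨hv, hv', hwt⟩ := upper_sound h'.1.1.1.2
  refine (c.code _).dZ_eq_of_witness hv hv' hwt fun w hw hw' => ?_
  have := c.lowZ_of_orbit hs o hgens hwords hviews hreach hprof w hw hw'
  omega

/-- **`d_X` from the orbit lane.** (theorem) -/
theorem dX_code_of_orbit (hs : c.checkStructure = true) (o : OrbitSide)
    (hgens : autGensOK c.n c.HZ c.HX o.gens = true) (hwords : autWordsOK o.gens.length o.words = true)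
    (hviews : ∀ s, s < o.views.length → infoSetStructOK c.n c.HZ (o.views.getD s dfltView).ic = true)
    (hreach : ∀ s, s < o.views.length → Reaches (bzLeaf (c.dX - 1) (c.sideX.found.map Prod.fst))
      (rowPos (kerBasis c.n (o.views.getD s dfltView).ic.piv (o.views.getD s dfltView).ic.red) 0)
      (o.views.getD s dfltView).t 0 0)
    (hprof : orbitProfileOK c.n (c.dX - 1) (o.words.map (wordPerm c.n (autPerms o.gens))) o.views o.cls o.mu = true)
    (hd : 1 ≤ c.dX) :
    (c.code (c.commOK_of_checkStructure hs)).dX = c.dX := by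
  have h' := hs
  simp only [checkStructure, Bool.and_eq_true] at h'
  obtain ⟨hv, hv', hwt⟩ := upper_sound h'.1.2
  refine (c.code _).dX_eq_of_witness hv hv' hwt fun w hw hw' => ?_
  have := c.lowX_of_orbit hs o hgens hwords hviews hreach hprof w hw hw'
  omega

end DistCert

/-! ## Controls (CERT-REQS A1): the `[[4,2,2]]` certificate of `Census/CertCheck.lean` through the orbit lane -/

/-- The `Z = X` side data of the `[[4,2,2]]` control: the cyclic shift `q ↦ q+1` of the 4 qubits (it fixes the single
check row `1111`), all four of its powers as words, ONE view with pivot column `0` (free columns `1,2,3`, kernel basis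
`0011₂, 0101₂, 1001₂`) at depth `0`, one class. Every weight-1 support has multiplicity `3 < 4 · (0 + 1)`: some shift
moves it onto the pivot, where a kernel vector with empty free support vanishes. (definition) -/
def orbitC422 : OrbitSide where
  gens := [⟨[1, 2, 3, 0], [0], [0]⟩]
  words := [[], [0], [0, 0], [0, 0, 0]]
  views := [⟨⟨[0], [15], [[0]]⟩, 0⟩]
  cls := [0, 0, 0, 0]
  mu := [[3]]

/-- The generator check passes (valid table, row maps on both matrices). -/
theorem orbitC422_gens : autGensOK 4 certC422.HX certC422.HZ orbitC422.gens = true := by decide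

/-- The words name generators. -/
theorem orbitC422_words : autWordsOK orbitC422.gens.length orbitC422.words = true := by decide

/-- The view's RREF certificate checks against `H^X = [1111]`. -/
theorem orbitC422_views : ∀ s, s < orbitC422.views.length →
    infoSetStructOK 4 certC422.HX (orbitC422.views.getD s dfltView).ic = true := by
  decide

/-- The profile check passes at `wmax = 1` (kernel `decide`: tables composed, multiplicities recounted, profiles
enumerated). -/
theorem orbitC422_prof :
    orbitProfileOK 4 1 (orbitC422.words.map (wordPerm 4 (autPerms orbitC422.gens))) orbitC422.views orbitC422.cls
      orbitC422.mu = true := by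
  decide

/-- NEGATIVE control: with the identity automorphism alone the same view at depth `0` is REJECTED (a weight-1 support on
a free column has multiplicity `1 ≥ 1 · (0 + 1)`). -/
theorem orbitC422_prof_neg :
    orbitProfileOK 4 1 [List.range 4] orbitC422.views [0, 1, 1, 1] [[0], [1]] = false := by decide

/-- The depth-`0` replay of the view's kernel basis (the empty selection only) passes. -/
theorem orbitC422_reach : ∀ s, s < orbitC422.views.length → Reaches (bzLeaf (certC422.dZ - 1)
    (certC422.sideZ.found.map Prod.fst))
    (rowPos (kerBasis 4 (orbitC422.views.getD s dfltView).ic.piv (orbitC422.views.getD s dfltView).ic.red) 0)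
    (orbitC422.views.getD s dfltView).t 0 0 := by
  intro s hs
  have hs0 : s = 0 := by simp [orbitC422] at hs; omega
  subst hs0
  exact reaches_of_scan (by decide)

/-- **End-to-end control**: every non-trivial `Z`-logical of the `[[4,2,2]]` certificate's code has weight `> 1`, through
the orbit lane (`lowZ_of_orbit`; the structural verdict is qec-search-9's `checkStructure_certC422`; `d_Z = 2` itself is
already `dZ_certC422_mitm` in `Census/CertCheckMitm.lean` and is not restated). -/
theorem lowZ_certC422_orbit : ∀ w : Fin certC422.n → ZMod 2, rowMatrix certC422.n certC422.HX *ᵥ w = 0 →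
    w ∉ rowSpace (rowMatrix certC422.n certC422.HZ) → certC422.dZ - 1 < hammingNorm w :=
  certC422.lowZ_of_orbit checkStructure_certC422 orbitC422 orbitC422_gens orbitC422_words orbitC422_views
    orbitC422_reach orbitC422_prof

end Summit.Ventures.QEC.Census
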